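import Literature.NumberTheory.Automorphic.SatakeParameterGenericBound
import Literature.NumberTheory.Automorphic.GJUnfoldingLocal
import Literature.NumberTheory.Automorphic.SatakeParametersGLProofs
import Literature.NumberTheory.Automorphic.SmoothRepresentationProofs
import HarnessLib

/-!
# The unramified local–global dictionary for Satake parameters, discharged

Topic `NumberTheory/Automorphic`; proof file (theorems only, no definition, no named fact) on top
of `SatakeParameterGenericBound`, whose named fact

* `Flath1979_isSatakeParameter_of_hasLocalComponentAt` — *if a cuspidal automorphic
  representation `Π` of `GL_n(𝔸_K)` has Hecke–Satake parameter `α` at `v` with respect to a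
  level `K(𝔫)`, `v ∤ 𝔫 ≠ 0` (`HasSatakeParameterAt`), and `ρ` is an irreducible admissible local
  component of `Π` at `v` (`HasLocalComponentAt`: a non-zero `GL_n(K_v)`-intertwiner
  `ι : V_ρ → Π` along `GL_n(K_v) ↪ GL_n(𝔸_K)`), then `α` is a Satake parameter of `ρ`
  (`IsSatakeParameter ρ ϖ' α` of `SatakeParametersGL`) for every uniformizer `ϖ'` of `K_v`* —

is input **(C)** of the assembly `norm_satakeParameter_le_sqrt_of_isGeneric` of Jacquet–Shalika's
bound `|μ_{j,v}| ≤ q_v^{1/2}` ((5.1.3) of Jacquet–Shalika (1981); named fact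
`norm_satakeParameter_le_sqrt` of `AutomorphicLFunctionProofs`). It is proved here
(`Flath1979_isSatakeParameter_of_hasLocalComponentAt_holds`), so that the bound in every rank now
rests on the three remaining printed inputs: existence of local components (Flath), genericity of
cuspidal local components (Shalika / Piatetski-Shapiro) and Jacquet–Shalika's local Cor. (2.5)
(`norm_satakeParameter_le_sqrt_of_isGeneric'`).

## The argument (all proved)

In print (Flath (1979), Thm. 3; Bump (1997), Thm. 3.3.3; Cartier (1979), §IV) one factors
`Π ≅ ⊗' Π_w`, so that `Π^{K(𝔫)} = Π_v^{GL_n(𝒪_v)} ⊗ (Π^v)^{K(𝔫)^v}` with the local operators `T_i`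
acting through the one-dimensional spherical line of `Π_v ≅ ρ`. Over the tree's honest `L²`
objects the same conclusion is reached without the tensor-product theorem, from two facts already
proved in the tree:

* the unramified local Hecke operators `[GL_n(𝒪_v) g GL_n(𝒪_v)]` act on the spherical vectors
  `Π^{GL_n(𝒪_v)} ⊂ L²` by scalars, and a Satake parameter `α` of `Π` at `v` (any level `K(𝔫)`,
  `v ∤ 𝔫`) gives the eigenvalue `q_v^{i(n-i)/2} e_i(α)` of `T_i` on *all* of `Π^{GL_n(𝒪_v)}`
  (`heckeOperator_rightRegularLocal_heckeDiag_eq_smul` of `GJUnfoldingLocal`, resting on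
  `Flath1979_heckeOperatorAt_sphericalLevelAt_eq_smul_holds` of `UnramifiedHeckeScalarsFlathProofs`:
  irreducibility of `Π` and the Gelfand pair `(GL_n(K_v), GL_n(𝒪_v))`);
* a `GL_n(𝒪_v)`-invariant linear form on a smooth representation which vanishes on the
  `GL_n(𝒪_v)`-fixed vectors vanishes identically (`IsSmooth.dual_eq_zero_of_forall_mem_fixedPoints`
  of `SmoothRepresentationProofs`, the projector `e_K`; Bernstein–Zelevinsky (1976), §2.13).

Given the intertwiner `ι : V_ρ → Π ≤ L²` (injective, `ρ` being irreducible):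

1. **`ρ` is unramified** (`exists_mem_fixedPoints_ne_zero_of_isTopIrreducible`,
   `exists_mem_fixedPoints_ne_zero_of_hasLocalComponentAt`). If
   `V_ρ^{GL_n(𝒪_v)} = 0`, then for every `GL_n(𝒪_v)`-invariant `y ∈ Π` the invariant form
   `x ↦ ⟪y, ι x⟫` vanishes (the `L²` action is unitary), so `ι(V_ρ) ⊥ y`. For `g ∈ GL_n(𝔸_K)` write
   `g = h · ι_v(g_v)` with `h_v = 1`; `h` commutes with `ι_v(GL_n(𝒪_v))`, so `R(h)⁻¹ F` is
   `GL_n(𝒪_v)`-invariant for the non-zero `K(𝔫)`-fixed eigenvector `F` of `HasSatakeParameterAt`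
   (`K(𝔫) ⊇ ι_v(GL_n(𝒪_v))`), whence `⟪F, R(g) ι x⟫ = ⟪R(h)⁻¹ F, ι(ρ(g_v) x)⟫ = 0`. Thus `F` is
   orthogonal to the `GL_n(𝔸_K)`-span of `ι(V_ρ) ≠ 0`, which is dense in the irreducible `Π`:
   `F = 0`, a contradiction.
2. **Transport of eigenvalues** (`heckeOperator_heckeDiag_apply_eq_smul_of_hasSatakeParameterAt`).
   For `x ∈ V_ρ^{GL_n(𝒪_v)}`, `ι x` is a spherical vector of `Π` at `v` and
   `ι (T_i x) = [GL_n(𝒪_v) t_i GL_n(𝒪_v)] (ι x) = q_v^{i(n-i)/2} e_i(α) ι x` (same transversal on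
   both sides; then the first fact), so `T_i x = q_v^{i(n-i)/2} e_i(α) x` by injectivity.
3. The uniformizer `ϖ` of `HasSatakeParameterAt` (`|ϖ|_v = exp (-1)`) and any uniformizer `ϖ'` of
   the local field `K_v` have the same valuation (`IsUniformizingElement.valuation_eq`), so `α` is
   a Hecke–Satake parameter with respect to `ϖ'` as well (`HasSatakeParameterAt.of_valuation_eq`),
   and `residueFieldCard K_v = q_v` (`residueFieldCard_adicCompletion_eq`).

## Main statements

* `Flath1979_isSatakeParameter_of_hasLocalComponentAt_holds`: the named fact (C), proved.
* `isUnramified_of_hasLocalComponentAt`: an irreducible smooth local component at `v` of a cuspidal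
  `Π` having a Satake parameter at `v` is unramified (`GL_n(𝒪_v)`-fixed vectors `≠ 0`).
* `norm_satakeParameter_le_sqrt_of_isGeneric'`: Jacquet–Shalika's bound (5.1.3) in every rank
  from the three remaining inputs (Flath's existence of local components, genericity, Cor. (2.5)).

## References

* D. Flath, *Decomposition of representations into tensor products*, Proc. Sympos. Pure Math. 33
  (Corvallis 1979), part 1, 179–183, Thm. 3 [Flath1979].
* D. Bump, *Automorphic forms and representations* (1997), Thm. 3.3.3, §3.3 [Bump1997].
* P. Cartier, *Representations of 𝔭-adic groups: a survey*, Corvallis (1979), §IV.1, §IV.4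
  [CartierCorvallis1979].
* I. N. Bernstein, A. V. Zelevinsky, *Representations of the group GL(n, F) where F is a local
  non-archimedean field*, Russian Math. Surveys 31 (1976), §2.13.
* H. Jacquet, J. A. Shalika, *On Euler products and the classification of automorphic
  representations I*, Amer. J. Math. 103 (1981), (5.1.3) p. 554, Cor. (2.5), Remark (2.6)
  [JacquetShalikaAJM1981].
-/

noncomputable section

open scoped MatrixGroups ComplexConjugate InnerProductSpace Valued
open NumberField IsDedekindDomain MeasureTheory ValuativeRel
open Literature.NumberTheory.GaloisRepresentations.IsNonarchimedeanLocalField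

namespace Literature.NumberTheory.Automorphic

/-! ### Two uniformizing elements have the same valuation -/

section Uniformizer

variable {F : Type*} [Field F] [ValuativeRel F]

/-- If `ϖ, ϖ'` both generate the maximal ideal of `𝒪[F]`, then `|ϖ'| ≤ |ϖ|` (`ϖ' = ϖ y` with `y`
integral). [folklore] -/
theorem IsUniformizingElement.valuation_le {ϖ ϖ' : F} (h : IsUniformizingElement ϖ)
    (h' : IsUniformizingElement ϖ') : valuation F ϖ' ≤ valuation F ϖ := by
  obtain ⟨y, hy, hyeq⟩ := h.exists_eq_mul h'.mem h'.valuation_lt_one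
  rw [hyeq, map_mul]
  calc valuation F ϖ * valuation F y ≤ valuation F ϖ * 1 :=
        mul_le_mul_right ((Valuation.mem_integer_iff _ _).1 hy) _
    _ = valuation F ϖ := mul_one _

/-- Two uniformizing elements of `F` have the same valuation (they are associated in `𝒪[F]`;
Cartier (1979), §IV.1: the double cosets `K ϖ^λ K` do not depend on `ϖ`). [folklore] -/
theorem IsUniformizingElement.valuation_eq {ϖ ϖ' : F} (h : IsUniformizingElement ϖ)
    (h' : IsUniformizingElement ϖ') : valuation F ϖ = valuation F ϖ' :=
  le_antisymm (h'.valuation_le h) (h.valuation_le h')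

end Uniformizer

/-! ### Local components of cuspidal representations: intertwiners and Hecke operators -/

section LocalComponent

variable {n : ℕ} {K : Type} [Field K] [NumberField K]
  {μ : Measure (AdelicGroupData.gl n K).automorphicQuotient}
  [(AdelicGroupData.gl n K).IsAutomorphicMeasure μ]

variable (n K) in
/-- `GL_n(𝒪_v)` (`glInt`, the valuation-ring language) is compact in `GL_n(K_v)`
(`isCompact_valuedCongruenceSubgroup_one` through the dictionary `glInt_adicCompletion_eq`;
Bump (1997), §3.3). [folklore] -/
theorem isCompact_glInt_adicCompletion (v : HeightOneSpectrum (𝓞 K)) :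
    IsCompact ((glInt n (v.adicCompletion K) : Subgroup (GL (Fin n) (v.adicCompletion K))) :
      Set (GL (Fin n) (v.adicCompletion K))) := by
  rw [glInt_adicCompletion_eq]
  exact isCompact_valuedCongruenceSubgroup_one n K v

variable (n K) in
/-- `GL_n(𝒪_v)` (`glInt`) is open in `GL_n(K_v)` (`isOpen_valuedCongruenceSubgroup_one`;
Bump (1997), §3.3). [folklore] -/
theorem isOpen_glInt_adicCompletion (v : HeightOneSpectrum (𝓞 K)) :
    IsOpen ((glInt n (v.adicCompletion K) : Subgroup (GL (Fin n) (v.adicCompletion K))) :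
      Set (GL (Fin n) (v.adicCompletion K))) := by
  rw [glInt_adicCompletion_eq]
  exact isOpen_valuedCongruenceSubgroup_one n K v

/-- `R(g g') z = R(g) (R(g') z)` on a closed subrepresentation of `L²(GL_n(K) A_G \\ GL_n(𝔸_K))`
(`map_mul`, stated for the `GL_n(𝔸_K)`-typed product so that it rewrites). [folklore] -/
theorem toContRep_mul_apply_gl
    (W : ContRepresentation.ClosedSubrep ((AdelicGroupData.gl n K).rightRegular μ))
    (g g' : GL (Fin n) (AdeleRing (𝓞 K) K)) (z : W.toSubmodule) :
    W.toContRep (g * g') z = W.toContRep g (W.toContRep g' z) :=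
  congrArg (fun T : W.toSubmodule →L[ℂ] W.toSubmodule => T z) (map_mul W.toContRep g g')

/-- `R(1) z = z` on a closed subrepresentation of `L²(GL_n(K) A_G \\ GL_n(𝔸_K))` (`map_one`).
[folklore] -/
theorem toContRep_one_apply_gl
    (W : ContRepresentation.ClosedSubrep ((AdelicGroupData.gl n K).rightRegular μ))
    (z : W.toSubmodule) :
    W.toContRep (1 : GL (Fin n) (AdeleRing (𝓞 K) K)) z = z :=
  congrArg (fun T : W.toSubmodule →L[ℂ] W.toSubmodule => T z) (map_one W.toContRep)

variable {P : CuspidalAutomorphicRepGL n K μ} {v : HeightOneSpectrum (𝓞 K)}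
  {V : Type*} [AddCommGroup V] [Module ℂ V]
  {ρ : Representation ℂ (GL (Fin n) (v.adicCompletion K)) V}
  {f : V →ₗ[ℂ] P.1.toSubmodule}

/-- An intertwiner `ι : V_ρ → Π` along `GL_n(K_v) ↪ GL_n(𝔸_K)` maps `GL_n(𝒪_v)`-fixed vectors of
`ρ` to spherical vectors of `Π` at `v` (`sphericalVectorsAt`: `R(ι_v k) (ι x) = ι (ρ(k) x) = ι x`;
Borel–Jacquet (1979), §4.6). [folklore] -/
theorem coe_mem_sphericalVectorsAt_of_mem_fixedPoints
    (hf : ∀ (g : GL (Fin n) (v.adicCompletion K)) (x : V),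
      f (ρ g x) = P.1.toContRep (GLn.ofLocal n K v g) (f x))
    {x : V} (hx : x ∈ ρ.fixedPoints (glInt n (v.adicCompletion K))) :
    ((f x : P.1.toSubmodule) : (AdelicGroupData.gl n K).L2 μ) ∈ sphericalVectorsAt μ P v := by
  refine mem_sphericalVectorsAt_iff.2 ⟨(f x).2, fun k hk => ?_⟩
  have h := congrArg Subtype.val (hf k x)
  rw [(ρ.mem_fixedPoints _ x).1 hx k hk, ContRepresentation.ClosedSubrep.coe_toContRep_apply] at h
  exact h.symm

/-- The image `ι x ∈ L²` of a `GL_n(𝒪_v)`-fixed vector is fixed by `GL_n(𝒪_v)` acting through the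
local representation `ρ_v = R ∘ ι_v` on `L²` (`rightRegularLocal`). [folklore] -/
theorem coe_mem_fixedPoints_rightRegularLocal
    (hf : ∀ (g : GL (Fin n) (v.adicCompletion K)) (x : V),
      f (ρ g x) = P.1.toContRep (GLn.ofLocal n K v g) (f x))
    {x : V} (hx : x ∈ ρ.fixedPoints (glInt n (v.adicCompletion K))) :
    ((f x : P.1.toSubmodule) : (AdelicGroupData.gl n K).L2 μ) ∈
      (rightRegularLocal μ v).fixedPoints (glInt n (v.adicCompletion K)) := by
  rw [Representation.mem_fixedPoints]
  intro k hk
  rw [rightRegularLocal_apply]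
  exact (mem_sphericalVectorsAt_iff.1 (coe_mem_sphericalVectorsAt_of_mem_fixedPoints hf hx)).2 k hk

/-- **Intertwiners commute with the unramified Hecke operators.** For `x ∈ V_ρ^{GL_n(𝒪_v)}` and
`g ∈ GL_n(K_v)`, `ι ([GL_n(𝒪_v) g GL_n(𝒪_v)] x) = [GL_n(𝒪_v) g GL_n(𝒪_v)] (ι x)`, the right side
computed in the local representation `ρ_v = R ∘ ι_v` on `L²`: both sides are `∑_{y ∈ s} (·)(y)`
over one transversal `s` of the finite double coset (`heckeOperator_apply_eq_sum`;
Bump (1997), §3.3; Cartier (1979), §IV.1). [folklore] -/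
theorem coe_map_heckeOperator_glInt
    (hf : ∀ (g : GL (Fin n) (v.adicCompletion K)) (x : V),
      f (ρ g x) = P.1.toContRep (GLn.ofLocal n K v g) (f x))
    {x : V} (hx : x ∈ ρ.fixedPoints (glInt n (v.adicCompletion K)))
    (g : GL (Fin n) (v.adicCompletion K)) :
    ((f (heckeOperator ρ (glInt n (v.adicCompletion K)) g x) : P.1.toSubmodule) :
        (AdelicGroupData.gl n K).L2 μ) =
      heckeOperator (rightRegularLocal μ v) (glInt n (v.adicCompletion K)) g
        ((f x : P.1.toSubmodule) : (AdelicGroupData.gl n K).L2 μ) := by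
  classical
  have hfin := finite_orbit_glInt g
  have hs := bijOn_mk_image_out (glInt n (v.adicCompletion K)) g hfin
  rw [heckeOperator_apply_eq_sum ρ (glInt n (v.adicCompletion K)) g _ hs hx,
    heckeOperator_apply_eq_sum (rightRegularLocal μ v) (glInt n (v.adicCompletion K)) g _ hs
      (coe_mem_fixedPoints_rightRegularLocal hf hx),
    map_sum, Submodule.coe_sum]
  refine Finset.sum_congr rfl fun y _ => ?_
  rw [hf, ContRepresentation.ClosedSubrep.coe_toContRep_apply, rightRegularLocal_apply]

/-- **Transport of the Satake eigenvalues to the local component.** If `Π` has Hecke–Satake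
parameter `α` at `v` with respect to `K(𝔫)`, `v ∤ 𝔫 ≠ 0`, and `ι : V_ρ → Π` is a non-zero
intertwiner out of an irreducible `ρ`, then on every `GL_n(𝒪_v)`-fixed `x ∈ V_ρ` the local Hecke
operator `T_i = [GL_n(𝒪_v) diag(ϖ^{(i)}, 1) GL_n(𝒪_v)]` acts by `q_v^{i(n-i)/2} e_i(α)`:
`ι (T_i x) = T_i (ι x) = q_v^{i(n-i)/2} e_i(α) ι x` by `coe_map_heckeOperator_glInt` and the
scalar action of `T_i` on all spherical vectors of `Π` at `v`
(`heckeOperator_rightRegularLocal_heckeDiag_eq_smul`), and `ι` is injective (Flath (1979),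
Thm. 3; Bump (1997), Thm. 3.3.3, p. 296). [folklore] -/
theorem heckeOperator_heckeDiag_apply_eq_smul_of_hasSatakeParameterAt
    {𝔫 : Ideal (𝓞 K)} (h𝔫 : 𝔫 ≠ 0) (hv : ¬ v.asIdeal ∣ 𝔫) {ϖ : (v.adicCompletion K)ˣ}
    {α : Multiset ℂ} (hα : HasSatakeParameterAt P.1 (principalCongruenceLevel n K 𝔫) v ϖ α)
    (hρ : ρ.IsIrreducible) (hf0 : f ≠ 0)
    (hf : ∀ (g : GL (Fin n) (v.adicCompletion K)) (x : V),
      f (ρ g x) = P.1.toContRep (GLn.ofLocal n K v g) (f x))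
    {x : V} (hx : x ∈ ρ.fixedPoints (glInt n (v.adicCompletion K))) {i : ℕ} (hi : i ≤ n) :
    heckeOperator ρ (glInt n (v.adicCompletion K)) (heckeDiag n ϖ i) x =
      ((((Real.sqrt (v.residueCard : ℝ) : ℝ) : ℂ) ^ (i * (n - i))) * α.esymm i) • x := by
  have hinj : Function.Injective f :=
    injective_of_isIrreducible_of_intertwines hρ
      ((P.1.toContRep.toRepresentation : GL (Fin n) (AdeleRing (𝓞 K) K) →* _).comp
        (GLn.ofLocal n K v)) hf0 (fun g x => hf g x)
  apply hinj
  apply Subtype.val_injective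
  rw [coe_map_heckeOperator_glInt hf hx, map_smul, Submodule.coe_smul,
    heckeOperator_rightRegularLocal_heckeDiag_eq_smul h𝔫 hv hα
      (coe_mem_sphericalVectorsAt_of_mem_fixedPoints hf hx) hi]

/-- **An irreducible `W ≤ L²` with a spherical vector at `v` has unramified local components at
`v`.** Let `W ≤ L²(GL_n(K) A_G \\ GL_n(𝔸_K))` be a topologically irreducible closed subrepresentation
with a Satake parameter at `v` with respect to `K(𝔫)`, `v ∤ 𝔫 ≠ 0` (so `W` has a non-zero vector
`F` fixed by `K(𝔫) ⊇ ι_v(GL_n(𝒪_v))`), and let `ι : V_ρ → W` be a non-zero intertwiner along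
`GL_n(K_v) ↪ GL_n(𝔸_K)` out of a smooth representation `ρ` of `GL_n(K_v)`. Then
`V_ρ^{GL_n(𝒪_v)} ≠ 0`. Otherwise every `GL_n(𝒪_v)`-invariant form `x ↦ ⟪y, ι x⟫` (`y ∈ W`
invariant under `ι_v(GL_n(𝒪_v))`, the `L²` action being unitary) vanishes
(`IsSmooth.dual_eq_zero_of_forall_mem_fixedPoints`); writing `g = h ι_v(g_v)` with `h_v = 1`
(`h` commutes with `ι_v(GL_n(𝒪_v))`) gives `⟪F, R(g) ι x⟫ = ⟪R(h)⁻¹ F, ι(ρ(g_v) x)⟫ = 0`, so `F`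
is orthogonal to the dense `GL_n(𝔸_K)`-span of `ι(V_ρ)` in the irreducible `W`, i.e. `F = 0`
(Flath (1979), Thm. 3: `Π_v` is unramified wherever `Π` has `GL_n(𝒪_v)`-fixed vectors;
Borel–Jacquet (1979), §4.6). [folklore] -/
theorem exists_mem_fixedPoints_ne_zero_of_isTopIrreducible
    {W : ContRepresentation.ClosedSubrep ((AdelicGroupData.gl n K).rightRegular μ)}
    (hW : W.toContRep.IsTopIrreducible)
    {𝔫 : Ideal (𝓞 K)} (h𝔫 : 𝔫 ≠ 0) (hv : ¬ v.asIdeal ∣ 𝔫) {ϖ : (v.adicCompletion K)ˣ}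
    {α : Multiset ℂ} (hα : HasSatakeParameterAt W (principalCongruenceLevel n K 𝔫) v ϖ α)
    (hsm : ρ.IsSmooth) {ι : V →ₗ[ℂ] W.toSubmodule} (hι0 : ι ≠ 0)
    (hι : ∀ (g : GL (Fin n) (v.adicCompletion K)) (x : V),
      ι (ρ g x) = W.toContRep (GLn.ofLocal n K v g) (ι x)) :
    ∃ x ∈ ρ.fixedPoints (glInt n (v.adicCompletion K)), x ≠ 0 := by
  have hU : W.toContRep.IsUnitary :=
    ClosedSubrep.isUnitary_toContRep ((AdelicGroupData.gl n K).isUnitary_rightRegular μ) W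
  obtain ⟨-, -, F₀, hF₀K, hF₀0, -⟩ := hα
  by_contra hnone
  push Not at hnone
  -- (A) `GL_n(𝒪_v)`-invariant vectors of `W` are orthogonal to `ι(V_ρ)`
  have hA : ∀ y : W.toSubmodule, (∀ k ∈ glInt n (v.adicCompletion K),
      W.toContRep (GLn.ofLocal n K v k) y = y) → ∀ x : V, ⟪y, ι x⟫_ℂ = 0 := by
    intro y hy x
    let φ : Module.Dual ℂ V := (innerₛₗ ℂ y) ∘ₗ ι
    have hφ : φ = 0 := by
      refine Representation.IsSmooth.dual_eq_zero_of_forall_mem_fixedPoints hsm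
        (isCompact_glInt_adicCompletion n K v) φ ?_ ?_
      · intro k hk x'
        show ⟪y, ι (ρ k x')⟫_ℂ = ⟪y, ι x'⟫_ℂ
        rw [hι, ← hU.inner_map_map (GLn.ofLocal n K v k) y (ι x'), hy k hk]
      · intro w hw
        rw [hnone w hw, map_zero]
    have := LinearMap.congr_fun hφ x
    simpa [φ] using this
  -- (B) `F₀` is orthogonal to every translate of every `ι x`
  have hmap : ∀ b : GL (Fin n) (v.adicCompletion K),
      Matrix.GeneralLinearGroup.map (AdelicGroupData.adeleEval K v) (GLn.ofLocal n K v b) = b :=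
    fun b => GLn.toLocal_ofLocal b
  have hB : ∀ (g : GL (Fin n) (AdeleRing (𝓞 K) K)) (x : V),
      ⟪F₀, W.toContRep g (ι x)⟫_ℂ = 0 := by
    intro g x
    set a : GL (Fin n) (v.adicCompletion K) :=
      Matrix.GeneralLinearGroup.map (AdelicGroupData.adeleEval K v) g with ha
    set h : GL (Fin n) (AdeleRing (𝓞 K) K) := g * GLn.ofLocal n K v a⁻¹ with hh
    set hi : GL (Fin n) (AdeleRing (𝓞 K) K) := h⁻¹ with hhi
    have hg : g = h * GLn.ofLocal n K v a := by
      rw [hh, mul_assoc, ← map_mul, inv_mul_cancel, map_one, mul_one]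
    have hha : Matrix.GeneralLinearGroup.map (AdelicGroupData.adeleEval K v) h = 1 := by
      rw [hh, map_mul, hmap, ← ha, mul_inv_cancel]
    have hhv : Matrix.GeneralLinearGroup.map (AdelicGroupData.adeleEval K v) hi = 1 := by
      rw [hhi, map_inv, hha, inv_one]
    have hih : hi * h = 1 := by
      rw [hhi]
      exact inv_mul_cancel h
    have hy : ∀ k ∈ glInt n (v.adicCompletion K),
        W.toContRep (GLn.ofLocal n K v k) (W.toContRep hi F₀) = W.toContRep hi F₀ := by
      intro k hk
      have hcomm : GLn.ofLocal n K v k * hi = hi * GLn.ofLocal n K v k :=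
        GLn.ofLocal_mul_eq_mul_ofLocal_of_toLocal_eq_one k hhv
      have hkK : GLn.ofLocal n K v k ∈ principalCongruenceLevel n K 𝔫 := by
        refine isMaximalAt_principalCongruenceLevel n K v h𝔫 hv ⟨k, ?_, rfl⟩
        rw [← glInt_adicCompletion_eq]
        exact hk
      have hF₀k : W.toContRep (GLn.ofLocal n K v k) F₀ = F₀ :=
        (W.mem_fixedVectors _ F₀).1 hF₀K _ hkK
      rw [← toContRep_mul_apply_gl, hcomm, toContRep_mul_apply_gl, hF₀k]
    calc ⟪F₀, W.toContRep g (ι x)⟫_ℂ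
        = ⟪F₀, W.toContRep h (ι (ρ a x))⟫_ℂ := by
          rw [hι, ← toContRep_mul_apply_gl, ← hg]
      _ = ⟪W.toContRep hi F₀, W.toContRep hi (W.toContRep h (ι (ρ a x)))⟫_ℂ :=
          (hU.inner_map_map hi _ _).symm
      _ = ⟪W.toContRep hi F₀, ι (ρ a x)⟫_ℂ := by
          rw [← toContRep_mul_apply_gl, hih, toContRep_one_apply_gl]
      _ = 0 := hA _ hy _
  -- (C) the vectors all of whose translates are orthogonal to `F₀` form a closed subrepresentation
  let U : ContRepresentation.ClosedSubrep W.toContRep :=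
    { toSubmodule :=
        { carrier := {z | ∀ g : GL (Fin n) (AdeleRing (𝓞 K) K), ⟪F₀, W.toContRep g z⟫_ℂ = 0}
          add_mem' := fun {z z'} hz hz' g => by
            rw [map_add, inner_add_right, hz g, hz' g, add_zero]
          zero_mem' := fun g => by rw [map_zero, inner_zero_right]
          smul_mem' := fun c z hz g => by
            calc ⟪F₀, W.toContRep g (c • z)⟫_ℂ = ⟪F₀, c • W.toContRep g z⟫_ℂ := by rw [map_smul]
              _ = c * ⟪F₀, W.toContRep g z⟫_ℂ := inner_smul_right F₀ (W.toContRep g z) c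
              _ = 0 := by rw [hz g, mul_zero] }
      apply_mem_toSubmodule := fun g z hz g' => by
        show ⟪F₀, W.toContRep g' (W.toContRep g z)⟫_ℂ = 0
        rw [← toContRep_mul_apply_gl]
        exact hz _
      isClosed' := by
        show IsClosed {z : W.toSubmodule |
          ∀ g : GL (Fin n) (AdeleRing (𝓞 K) K), ⟪F₀, W.toContRep g z⟫_ℂ = 0}
        rw [Set.setOf_forall]
        exact isClosed_iInter fun g =>
          isClosed_eq (continuous_const.inner (W.toContRep g).continuous) continuous_const }
  have hιU : ∀ x : V, ι x ∈ U := fun x g => hB g x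
  rcases ((ContRepresentation.isTopIrreducible_iff _).1 hW).2 U with hbot | htop
  · apply hι0
    refine LinearMap.ext fun x => ?_
    have hx := hιU x
    rw [hbot, ContRepresentation.ClosedSubrep.mem_bot] at hx
    rw [LinearMap.zero_apply]
    exact hx
  · apply hF₀0
    have hF₀U : F₀ ∈ U := by
      rw [htop]
      exact ContRepresentation.ClosedSubrep.mem_top _
    have h1 := hF₀U 1
    rw [toContRep_one_apply_gl] at h1
    exact inner_self_eq_zero.1 h1

/-- **A local component at an unramified place is unramified.** If the cuspidal `Π` has a Satake
parameter at `v` with respect to `K(𝔫)`, `v ∤ 𝔫 ≠ 0`, and `ρ` is a smooth local component of `Π`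
at `v` (`HasLocalComponentAt`), then `ρ` has a non-zero `GL_n(𝒪_v)`-fixed vector
(`exists_mem_fixedPoints_ne_zero_of_isTopIrreducible` for the irreducible `Π`; Flath (1979),
Thm. 3; Borel–Jacquet (1979), §4.6). [folklore] -/
theorem exists_mem_fixedPoints_ne_zero_of_hasLocalComponentAt
    {𝔫 : Ideal (𝓞 K)} (h𝔫 : 𝔫 ≠ 0) (hv : ¬ v.asIdeal ∣ 𝔫) {ϖ : (v.adicCompletion K)ˣ}
    {α : Multiset ℂ} (hα : HasSatakeParameterAt P.1 (principalCongruenceLevel n K 𝔫) v ϖ α)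
    (hsm : ρ.IsSmooth) (hloc : HasLocalComponentAt P.1 v ρ) :
    ∃ x ∈ ρ.fixedPoints (glInt n (v.adicCompletion K)), x ≠ 0 := by
  obtain ⟨f, hf0, hf⟩ := hloc
  exact exists_mem_fixedPoints_ne_zero_of_isTopIrreducible P.isTopIrreducible h𝔫 hv hα hsm hf0 hf

/-- **A local component at an unramified place is unramified** (`Representation.IsUnramified`
form of `exists_mem_fixedPoints_ne_zero_of_hasLocalComponentAt`): if `Π` is unramified at `v` in
the sense of `HasSatakeParameterAt` (level `K(𝔫)`, `v ∤ 𝔫 ≠ 0`) and `ρ` is a smooth local component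
of `Π` at `v`, then `ρ` has non-zero `GL_n(𝒪_v)`-fixed vectors (Flath (1979), Thm. 3;
Borel–Jacquet (1979), §4.6). [folklore] -/
theorem isUnramified_of_hasLocalComponentAt {𝔫 : Ideal (𝓞 K)} (h𝔫 : 𝔫 ≠ 0)
    (hv : ¬ v.asIdeal ∣ 𝔫) {ϖ : (v.adicCompletion K)ˣ} {α : Multiset ℂ}
    (hα : HasSatakeParameterAt P.1 (principalCongruenceLevel n K 𝔫) v ϖ α) (hsm : ρ.IsSmooth)
    (hloc : HasLocalComponentAt P.1 v ρ) : ρ.IsUnramified (glInt n (v.adicCompletion K)) := by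
  obtain ⟨x, hx, hx0⟩ := exists_mem_fixedPoints_ne_zero_of_hasLocalComponentAt h𝔫 hv hα hsm hloc
  rw [Representation.isUnramified_iff, Submodule.ne_bot_iff]
  exact ⟨x, hx, hx0⟩

/-- **The unramified local–global dictionary (Flath (1979), Thm. 3), discharged**: the named
fact `Flath1979_isSatakeParameter_of_hasLocalComponentAt` of `SatakeParameterGenericBound` holds.
Given the Hecke–Satake parameter `α` of `Π` at `v` (level `K(𝔫)`, `v ∤ 𝔫 ≠ 0`, uniformizer `ϖ`
with `|ϖ|_v = exp (-1)`) and an irreducible admissible local component `ρ` of `Π` at `v` with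
intertwiner `ι`, pick a non-zero `x ∈ V_ρ^{GL_n(𝒪_v)}`
(`exists_mem_fixedPoints_ne_zero_of_hasLocalComponentAt`); any uniformizer `ϖ'` of the local
field `K_v` has `|ϖ'|_v = |ϖ|_v = exp (-1)` (two uniformizing elements have the same valuation), so
`α` is also the Hecke–Satake parameter with respect to `ϖ'` (`HasSatakeParameterAt.of_valuation_eq`)
and the operators `T_i` defined by `ϖ'` act on `x` by `q_v^{i(n-i)/2} e_i(α)`
(`heckeOperator_heckeDiag_apply_eq_smul_of_hasSatakeParameterAt`), and
`q_v = residueFieldCard K_v` (`residueFieldCard_adicCompletion_eq`); with `card α = n` this is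
`IsSatakeParameter ρ ϖ' α` (Bump (1997), Thm. 3.3.3 p. 296, p. 297; Cartier (1979), §IV.1,
§IV.4). [cite: Flath1979, Thm. 3] [cite: Bump1997, Thm. 3.3.3 p. 296, p. 297]
[cite: CartierCorvallis1979, §IV.1, §IV.4] -/
theorem Flath1979_isSatakeParameter_of_hasLocalComponentAt_holds :
    Flath1979_isSatakeParameter_of_hasLocalComponentAt (n := n) (K := K) (μ := μ) := by
  intro P 𝔫 h𝔫 v hv ϖ α hα V _ _ ρ hirr hadm hloc ϖ' hϖ'
  obtain ⟨f, hf0, hf⟩ := hloc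
  obtain ⟨x, hx, hx0⟩ :=
    exists_mem_fixedPoints_ne_zero_of_isTopIrreducible P.isTopIrreducible h𝔫 hv hα hadm.isSmooth
      hf0 hf
  refine ⟨hα.card_eq, x, hx, hx0, fun i hi => ?_⟩
  -- the uniformizer `ϖ'` of the local field has `|ϖ'|_v = exp (-1) = |ϖ|_v`
  have hval : valuation (v.adicCompletion K) ((ϖ : (v.adicCompletion K)ˣ) : v.adicCompletion K) =
      valuation (v.adicCompletion K) ((ϖ' : (v.adicCompletion K)ˣ) : v.adicCompletion K) :=
    (isUniformizingElement_of_valued_eq K v hα.1).valuation_eq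
      (isUniformizingElement_of_isUniformizer hϖ')
  have hϖ'v : Valued.v ((ϖ' : (v.adicCompletion K)ˣ) : v.adicCompletion K) =
      WithZero.exp (-1 : ℤ) := by
    rw [← hα.1]
    exact ((ValuativeRel.isEquiv (valuation (v.adicCompletion K))
      (Valued.v : Valuation (v.adicCompletion K) _)).eq_iff.1 hval).symm
  have hα' : HasSatakeParameterAt P.1 (principalCongruenceLevel n K 𝔫) v ϖ' α :=
    hα.of_valuation_eq (isMaximalAt_principalCongruenceLevel n K v h𝔫 hv) hϖ'v
  rw [heckeT_def, heckeOperator_heckeDiag_apply_eq_smul_of_hasSatakeParameterAt h𝔫 hv hα' hirr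
    hf0 hf hx hi, residueFieldCard_adicCompletion_eq K v, Complex.ofReal_pow]

end LocalComponent

/-! ### Jacquet–Shalika's bound from the three remaining inputs -/

section Assembly

variable {n : ℕ} {K : Type} [Field K] [NumberField K]
  {μ : Measure (AdelicGroupData.gl n K).automorphicQuotient}
  [(AdelicGroupData.gl n K).IsAutomorphicMeasure μ]

/-- **Jacquet–Shalika's bound (5.1.3) in every rank from the three remaining printed inputs.**
With the unramified dictionary (C) now a theorem
(`Flath1979_isSatakeParameter_of_hasLocalComponentAt_holds`), the named fact
`norm_satakeParameter_le_sqrt` of `AutomorphicLFunctionProofs` (`|a| ≤ q_v^{1/2}` for every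
Hecke–Satake parameter of a cuspidal automorphic representation of `GL_n(𝔸_K)` at an unramified
place) follows from: the existence of irreducible admissible local components
(`exists_hasLocalComponentAt`, Flath (1979)), the genericity of cuspidal local components
(`Shalika1974_isGeneric_of_hasLocalComponentAt`, Shalika (1974) / Piatetski-Shapiro) and
Jacquet–Shalika's local Cor. (2.5) (`JacquetShalika1981_norm_lt_sqrt_of_isGeneric`) — exactly the
proof of (5.1.3) indicated in Jacquet–Shalika (1981), Remark (2.6)(3)
(`norm_satakeParameter_le_sqrt_of_isGeneric`).
[cite: JacquetShalikaAJM1981, (5.1.3) p. 554, Remark (2.6)] -/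
theorem norm_satakeParameter_le_sqrt_of_isGeneric'
    (hF : exists_hasLocalComponentAt (n := n) (K := K) (μ := μ))
    (hA : Shalika1974_isGeneric_of_hasLocalComponentAt (n := n) (K := K) (μ := μ))
    (hB : ∀ (v : HeightOneSpectrum (𝓞 K)) {V : Type} [AddCommGroup V] [Module ℂ V]
      (ρ : Representation ℂ (GL (Fin n) (v.adicCompletion K)) V),
      JacquetShalika1981_norm_lt_sqrt_of_isGeneric ρ) :
    norm_satakeParameter_le_sqrt (n := n) (K := K) (μ := μ) :=
  norm_satakeParameter_le_sqrt_of_isGeneric hF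
    Flath1979_isSatakeParameter_of_hasLocalComponentAt_holds hA hB

end Assembly

end Literature.NumberTheory.Automorphic
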